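import Mathlib.Analysis.Calculus.Deriv.Mul
import Mathlib.Analysis.SpecialFunctions.Trigonometric.DerivHyp
import Mathlib.Analysis.Calculus.IteratedDeriv.Defs
import Mathlib.Analysis.Convex.Function
import Mathlib.Analysis.InnerProductSpace.PiL2
import Literature.Geometry.Riemannian.LiQingShiPinching
import Literature.Geometry.Riemannian.LiQingShiPinchingDecomposition
import Summits.SmoothPoincare4.SmoothPoincare4.Theses.InformationMetricHadamard
import Summits.SmoothPoincare4.SmoothPoincare4.Theses.EinsteinBulk
import Summits.SmoothPoincare4.SmoothPoincare4.Theorems.InformationMetricHadamardYamabePinchedEinsteinBulkReduction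
import Summits.SmoothPoincare4.SmoothPoincare4.Theorems.InformationMetricHadamardYamabePinchedEinsteinBulkStubBishopDefect
import Summits.SmoothPoincare4.SmoothPoincare4.Theorems.InformationMetricHadamardYamabePinchedEinsteinBulkStubWeylTracefreeRiccati
import Summits.SmoothPoincare4.SmoothPoincare4.Theorems.InformationMetricHadamardYamabePinchedEinsteinBulkStubSemiconvexLaplacian
import Summits.SmoothPoincare4.SmoothPoincare4.Theorems.InformationMetricHadamardYamabePinchedEinsteinBulkHelperDefectBudget
import Summits.SmoothPoincare4.SmoothPoincare4.Theorems.InformationMetricHadamardYamabePinchedEinsteinBulkHelperRayWindow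

/-!
# Line `Sketch` — skeleton for crux `YamabePinchedEinsteinBulk`
(item stmt-SmoothPoincare4-7996; routes `InformationMetricHadamard` (rank 6) and `EinsteinBulk` (rank 2);
idea cards `Cruxes/YamabePinchedEinsteinBulk/Ideas/tracefree-riccati-defect.md` and
`…/semiconcave-visual-energy.md` (ideator 1), whose `Sketch.lean` is this line; lead
`prover-line-stmt-SmoothPoincare4-7996-0`, 2026-08-17.)

Crux (fixed, never restated): Li–Qing–Shi 2017, Thm. 1.8 at `n = 5` — for every `ε > 0` there is
`δ > 0` such that every `C²`-conformally compact Einstein `(N⁵, g)`, `Ric_g = -4g`, whose conformal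
infinity `(M⁴, [g₀])` has `Y(M,[g₀]) ≥ (1-δ)·8√6π`, has `|K + 1| ≤ ε` for all sectional curvatures.
It is the tree's named fact `Literature.Geometry.Riemannian.liQingShi_pinching_five` typed verbatim
(`liQingShi_pinching_five.inlined` has literally the route decl's shape).

## The line

The printed proof has two layers and the tree PROVES the split
(`liQingShi_pinching_five_holds_of`, `LiQingShiPinchingDecomposition.lean`):
child 1 `liQingShi_volumeComparison_five` (Thm. 1.5: hyperbolic volume ratio `≥ (1-δ)²` from the
Yamabe bound) and child 2 `liQingShi_curvatureGap_five` (curvature gap from the volume gap). The two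
cards attack the children WITHOUT compactness arguments: child 2 through the Bishop-defect budget
`D' = |𝒰°|² − D(4 coth t + H)/4` along rays and the trace-free Riccati extraction of the radial Weyl
operator (`tracefree-riccati-defect`), child 1 through the distributional sign of the cut-locus term
for semiconcave distance functions (`semiconcave-visual-energy`).

Registered stubs:

* `stub_volumeComparison` (child 1; XL; existing named fact [cite: LiQingShi2017, Thm. 1.5]) and
  `stub_curvatureGap` (child 2; XL; existing named fact [cite: LiQingShi2017, Thm. 1.8 proof,
  Steps 1–2]; HARDEST, held by the lead) — the apex, literature debts;
* `helper_reduction` — the crux from the two children (LANDED p146290: the tree's assembly + `.inlined`);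
* `stub_bishopDefect` (P1a, LANDED p148130), `stub_weylTracefreeRiccati` (P1b, LANDED p147964) — the
  matrix layer of `tracefree-riccati-defect` (pure Mathlib matrix calculus);
* `stub_semiconvexLaplacian` — the first lemma of `semiconcave-visual-energy` (real analysis on
  `ℝ⁴`; LANDED p148274).
* `helper_defectBudget`, `helper_rayWindowIdentity` — the K3 matrix layer of
  `tracefree-riccati-defect` (the lead's pieces of `stub_curvatureGap`): the Bishop defect budget
  pays for the windowed `L²` norm of `𝒰°`, and `⟨𝒲e,e⟩` is a total derivative plus terms quadratic
  in `𝒰°` (LANDED, see imports).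

The composition `YamabePinchedEinsteinBulk_of` concludes the crux BY NAME from `helper_reduction`
and the two apex stubs (and `YamabePinchedEinsteinBulk_of'` the `EinsteinBulk` copy).
-/

noncomputable section

-- the prescribed namespace `Summit.<P>.<Sub>.…` duplicates `SmoothPoincare4` (P = Sub)
set_option linter.dupNamespace false

open scoped Manifold ContDiff Topology ENNReal NNReal
open Set Function MeasureTheory

namespace Summit.SmoothPoincare4.SmoothPoincare4.Cruxes.YamabePinchedEinsteinBulk.Sketch

open Literature.Geometry.Riemannian (liQingShi_volumeComparison_five liQingShi_curvatureGap_five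
  liQingShi_pinching_five liQingShi_pinching_five_holds_of)

/-! ## Apex stubs — the two printed layers (existing named facts; literature debts) -/

/-- Child 1 (Li–Qing–Shi 2017, Thm. 1.5 at `n = 5`, ball form): the hyperbolic volume ratio of a
Poincaré–Einstein filling is `≥ (1-δ)²` when `Y(M,[g₀]) ≥ (1-δ) Y(S⁴)`.
Target of card `semiconcave-visual-energy`. [cite: LiQingShi2017, Thm. 1.5] -/
theorem stub_volumeComparison : liQingShi_volumeComparison_five := by
  sorry

/-- Child 2 (Li–Qing–Shi 2017, proof of Thm. 1.8, Steps 1–2, at `n = 5`): the curvature gap from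
the volume gap. Target of card `tracefree-riccati-defect` (HARDEST; held by the lead).
[cite: LiQingShi2017, Thm. 1.8 (proof, pp. 12–13)] -/
theorem stub_curvatureGap : liQingShi_curvatureGap_five := by
  sorry

/-! ## Reduction helper — the crux from the two children -/

-- `helper_reduction`: LANDED (p146290) — see the imported Theorems module `…YamabePinchedEinsteinBulkReduction` (stub closed).

/-! ## Matrix layer of `tracefree-riccati-defect` (P1) -/

-- `stub_bishopDefect`: LANDED (p148130) — see the imported Theorems module `…StubBishopDefect` (stub closed).

-- `stub_weylTracefreeRiccati`: LANDED (p147964) — see the imported Theorems module `…StubWeylTracefreeRiccati` (stub closed).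

/-! ## K3 matrix layer of `tracefree-riccati-defect` (the lead's helpers toward `stub_curvatureGap`) -/

-- `helper_defectBudget`: LANDED (p150221) — see the imported Theorems module `…HelperDefectBudget`
--   (`∫ η tr((𝒰°)²) ≤ (C + 2 coth t₁) ∫ (4 coth t − tr 𝒰)` on a window `[t₁,t₂]`, from `stub_bishopDefect`).

-- `helper_rayWindowIdentity`: LANDED (p150277) — see the imported Theorems module `…HelperRayWindow`
--   (`∫ η ⟨𝒲e,e⟩ = ∫ (η'⟨𝒰°e,e⟩ − η (tr 𝒰/2)⟨𝒰°e,e⟩ − η⟨((𝒰°)² − (tr(𝒰°)²/4)I)e,e⟩)`, from `stub_weylTracefreeRiccati`).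

/-! ## First lemma of `semiconcave-visual-energy` -/

-- `stub_semiconvexLaplacian`: LANDED (p148274) — see the imported Theorems module `…StubSemiconvexLaplacian` (stub closed).

/-! ## The composition (kernel-checked; no `sorry` of its own) -/

/-- **Line `Sketch` concludes the crux BY NAME** (route `InformationMetricHadamard`): the two
children give the fact (tree assembly), and the fact is the route decl (`helper_reduction`). -/
theorem YamabePinchedEinsteinBulk_of :
    Summit.SmoothPoincare4.SmoothPoincare4.Theses.InformationMetricHadamard.YamabePinchedEinsteinBulk :=
  helper_reduction stub_volumeComparison stub_curvatureGap

/-- The `EinsteinBulk` copy of the crux (same statement, filed first per the cone rule), from the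
same two children through the fact. -/
theorem YamabePinchedEinsteinBulk_of' :
    Summit.SmoothPoincare4.SmoothPoincare4.Theses.EinsteinBulk.YamabePinchedEinsteinBulk :=
  liQingShi_pinching_five.inlined (liQingShi_pinching_five_holds_of stub_volumeComparison stub_curvatureGap)

end Summit.SmoothPoincare4.SmoothPoincare4.Cruxes.YamabePinchedEinsteinBulk.Sketch

end
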